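import Summits.BirchSwinnertonDyer.BirchSwinnertonDyer.Theorems.CyclotomicUntwistStabilisedTwistOldformsC1
import Summits.BirchSwinnertonDyer.BirchSwinnertonDyer.Theorems.CyclotomicUntwistC1OfStabilisedUntwistRootLaw
import Summits.BirchSwinnertonDyer.BirchSwinnertonDyer.Theorems.CyclotomicUntwistUniformRootLawBridge
import HarnessLib

/-!
# C1 `PSUntwistedLFunctionAtThree` from PRINT BY NAME (four facts, NO Atkin–Li) and the UNIFORM ROOT LAW in
# the K1 lead's Galois currency (route `CyclotomicUntwist`, child C1 = stmt-BirchSwinnertonDyer-27548)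

Cell `pub/bsd-wall` (D-0145 line `route-BirchSwinnertonDyer-CyclotomicUntwist`), width seat
`bsd-line-cycu-p4` (gen 12). THEOREMS ONLY (no definition, no named fact, no `sorry`); helper
`--supports stmt-BirchSwinnertonDyer-27548`. BSD is not proved by this file; C1 is NOT closed by it (it stays
conditional on the uniform root law `hU` and on print); K1/K2 stay OPEN and WHOLE.

Two roads to C1 now meet at the SAME research hypothesis `hU` — the UNIFORM ROOT LAW on every principal-series
row, in the currency of the K1 lead's announced `uniformRootLaw_of_print` (Deligne's `ρ_g`, Carayol (A), the
inertia of `V_ℓ(E)` at `3` through `Gal(ℚ₃(ζ₉)/ℚ₃)`): `∃ η` primitive mod `9`, `∃ α ∈ ℂ` with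
`α² − a_w(W)α + 3 = 0`, such that for every `T₀ ≠ 0` every newform `g₀` with `a_ℓ(g₀) = η⁻¹(ℓ)a_ℓ(W)` and
`ε_{g₀}(ℓ) = η⁻¹(ℓ)²` at all primes `ℓ ∤ T₀` has `a₃(g₀) = α`.
* Road AL (sibling `bsd-line-cycu-p5`, `PSUniformRootLawBridge.psUntwistedLFunctionAtThree_of_print_of_atkinLi_of_uniformRootLaw`):
  C1 ⟸ {modularity, Carayol level, GZ86 I.(7.3), GZK, **Atkin–Li 1978 Thm. 3.2** (named fact)} + `hU`.
* Road N1 (this file, `psUntwistedLFunctionAtThree_of_print_of_uniformRootLaw`):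
  C1 ⟸ {modularity, Carayol level, GZ86 I.(7.3), GZK} + `hU` — the Atkin–Li fact is replaced by the
  KERNEL theorem `PSStabilisedTwistOldforms.exists_stabilisedOldform_of_twist` (the stabilised oldform
  factorisation of the twist, proved from the `Γ₁` eigenpacket span without strong multiplicity one), whose
  uniform-`U_p`-eigenvalue hypothesis is exactly what `hU` asserts.
The `ℚ(ζ₆)` bookkeeping (lifting `η` and `α` to `K = CyclotomicField 6 ℚ` along `ι : K →+* ℂ`) is cycu-p5's
(`PSC1OfStabilisedUntwist.exists_ringHomComp_eq_of_pow_six`, `exists_preimage_root_complex`), and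
`η_K² ≠ 1` is `PSUniformRootLawBridge.sq_ne_one_of_isPrimitive_nine`.

References: [cite: MazurTateTeitelbaum1986Invent, §I.14] · [cite: Carayol1986, Thm. (A)] ·
[cite: GrossZagier1986, Thm. I.(7.3)] · [cite: DiamondShurman2005, Thm. 5.8.3] · [cite: AtkinLi1978, §3].
-/

noncomputable section

open scoped MatrixGroups

open CongruenceSubgroup UpperHalfPlane
  Literature.NumberTheory.EllipticCurves Literature.NumberTheory.EllipticCurves.ModularForms
  Literature.NumberTheory.EllipticCurves.Rank1Residual Literature.NumberTheory.IwasawaTheory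
  Summit.BirchSwinnertonDyer.BirchSwinnertonDyer.Theses.CyclotomicUntwist

-- single-conjunct summit: `Summit.BirchSwinnertonDyer.BirchSwinnertonDyer.…` repeats the name by design
set_option linter.dupNamespace false
set_option autoImplicit false

namespace Summit.BirchSwinnertonDyer.BirchSwinnertonDyer.Theorems.PSC1OfUniformRootLaw

/-- **C1 `PSUntwistedLFunctionAtThree` ⟸ PRINT BY NAME (modularity, Carayol's level, Gross–Zagier I.(7.3),
Gross–Zagier–Kolyvagin — NO Atkin–Li fact) + the UNIFORM ROOT LAW `hU`** (same text as the hypothesis `hU` of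
`PSUniformRootLawBridge.psUntwistedLFunctionAtThree_of_print_of_atkinLi_of_uniformRootLaw`, i.e. the conclusion of
the K1 lead's `uniformRootLaw_of_print` under the principal-series binders). Proof: `K = ℚ(ζ₆)` with
`ι, ι₃` by `IsAlgClosed.lift`; lift `η ↦ η_K`, `α ↦ α_K`; the uniform clause of
`PSStabilisedTwistOldformsC1.psUntwistedLFunctionAtThree_of_print_of_uniformRootLaw` at `T₀ := 9N` follows from
`hU` since `a_ℓ(f) = a_ℓ(W)` (`IsNewformOf`). [cite: MazurTateTeitelbaum1986Invent, §I.14]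
[cite: Carayol1986, Thm. (A)] [cite: GrossZagier1986, Thm. I.(7.3)] [cite: DiamondShurman2005, Thm. 5.8.3] -/
theorem psUntwistedLFunctionAtThree_of_print_of_uniformRootLaw
    (hmod : nonempty_modularParametrizationData)
    (hlev : ∀ (N : ℕ) [NeZero N], IsNewformOf.level_eq_conductorNorm (N := N))
    (hGZ86 : GrossZagier1986_thm_I_7_3) (hGZK : PublishedInputGZK)
    (hU : ∀ (W : WeierstrassCurve ℚ) [W.IsElliptic] [W.IsGloballyMinimal], ¬ W.HasCM →
      Summit.BirchSwinnertonDyer.Rank1Residual.Additive.ClassO6 W 3 → Surj W 3 →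
      Even (padicValInt 3 W.minimalDiscriminantInt) →
      W.minimalDiscriminantInt / 3 ^ padicValInt 3 W.minimalDiscriminantInt % 3 = 1 →
      W.analyticRank = 1 →
      ∃ η : DirichletCharacter ℂ (3 ^ 2), η.IsPrimitive ∧ ∃ α : ℂ,
        α ^ 2 - ((W.psUntwistedTrace : ℤ) : ℂ) * α + 3 = 0 ∧
        ∀ T₀ : ℕ, T₀ ≠ 0 → ∀ {N₀ : ℕ} [NeZero N₀] (g₀ : CuspForm (Gamma1 N₀) 2), IsNewform1 g₀ →
          (∀ ℓ : ℕ, ℓ.Prime → ¬ ℓ ∣ T₀ →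
            cuspCoeff g₀ ℓ = η⁻¹ (ℓ : ZMod (3 ^ 2)) * (W.LFunction ℓ : ℂ) ∧
              nebentypus g₀ (ℓ : ZMod N₀) = η⁻¹ (ℓ : ZMod (3 ^ 2)) ^ 2) →
          cuspCoeff g₀ 3 = α) :
    PSUntwistedLFunctionAtThree := by
  classical
  -- the coefficient field `K = ℚ(ζ₆)` with its two embeddings (as in cycu-p5's `PSC1OfStabilisedUntwist`)
  obtain ⟨μ, hμ⟩ : ∃ μ : CyclotomicField 6 ℚ, IsPrimitiveRoot μ 6 := by
    have hs := Polynomial.SplittingField.splits (Polynomial.cyclotomic 6 ℚ)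
    rw [Polynomial.map_cyclotomic] at hs
    obtain ⟨μ, hμ⟩ := hs.exists_eval_eq_zero (Polynomial.degree_cyclotomic_pos 6 _ (by norm_num)).ne'
    exact ⟨μ, Polynomial.isRoot_cyclotomic_iff.mp hμ⟩
  let ι : CyclotomicField 6 ℚ →+* ℂ := (IsAlgClosed.lift : CyclotomicField 6 ℚ →ₐ[ℚ] ℂ).toRingHom
  let ιp : CyclotomicField 6 ℚ →+* ℂ_[3] := (IsAlgClosed.lift : CyclotomicField 6 ℚ →ₐ[ℚ] ℂ_[3]).toRingHom
  obtain ⟨δ₀, hδ₀⟩ := PSC1OfStabilisedUntwist.exists_sq_eq_neg_three hμ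
  refine PSStabilisedTwistOldformsC1.psUntwistedLFunctionAtThree_of_print_of_uniformRootLaw ιp ι hmod hlev hGZ86
    hGZK fun W _ _ hCM hO6 hsurj hev hsq hr N _ f hf ↦ ?_
  obtain ⟨η, hηprim, α, hαroot, hunif⟩ := hU W hCM hO6 hsurj hev hsq hr
  obtain ⟨ηK, hηK⟩ := PSC1OfStabilisedUntwist.exists_ringHomComp_eq_of_pow_six ι hμ η
  obtain ⟨αK, hαK, hαKroot⟩ := PSC1OfStabilisedUntwist.exists_preimage_root_complex ι hδ₀ W hαroot
  have hηKprim : ηK.IsPrimitive := by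
    rw [← Literature.NumberTheory.EllipticCurves.isPrimitive_ringHomComp_iff ι ηK, hηK]
    exact hηprim
  have hηK2 : ηK ^ 2 ≠ 1 := PSUniformRootLawBridge.sq_ne_one_of_isPrimitive_nine (by simpa using hηKprim)
  refine ⟨ηK, αK, hηKprim, hηK2, hαKroot, fun M₀ _ g hg _ hpk ↦ ?_⟩
  rw [hαK]
  refine hunif (N * 3 ^ 2) (mul_ne_zero (NeZero.ne N) (by norm_num)) g hg fun ℓ hℓ hℓT ↦ ?_
  obtain ⟨h1, h2⟩ := hpk ℓ hℓ hℓT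
  rw [hηK] at h1 h2
  exact ⟨by rw [h1, hf.2 ℓ], h2⟩

end Summit.BirchSwinnertonDyer.BirchSwinnertonDyer.Theorems.PSC1OfUniformRootLaw

end
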